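import Summits.CriticalPhenomena.PercolationContinuityZ3.Theorems.Transplant.SkelPhiApron
import Summits.CriticalPhenomena.PercolationContinuityZ3.Theorems.Transplant.TwoAxisExitFrame
import HarnessLib

/-!
# N1 (the `{±1}` node), LEVEL 1, kit adapter file N-K4b: SIDE FORMS OF A WINDOW MAP AND THE PLACEMENT OF THE APRON — the dictionary between the
# depth behind a side of a `ψ`-box and a half-plane `{L ∘ φ ≥ θ}` of the base chart, the height profile of the apron below the shell line, and the
# row of the kit centre above it (planar arithmetic only)

builds on p205010 (kernel theorem, internal audit signed; external expert review pending) — nothing in this file uses p205010; nothing here is a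
claim about the open node `SamePDropOfSkeletonNeg`.
Lane `prim-bschramm`, seat `prim-bschramm-p1` (gen 11; apron-kit design KIT-APRON-N1, lane INBOX 2026-08-21 13:56Z, no objection lead g6 14:20Z / hp-8
14:03Z); helper file (`--supports stmt-CriticalPhenomena-4575 --as helper`).
WHY.  Every side of a `ψ`-box of an exit frame (or of a run frame) is a SHARP half-plane of the base chart: raw sides are lines `φ_b = const`, level
sides are lines `λ = mU − s` of the level form.  A `SideForm ψ φ Lo Hi i₀ σ₀` records this for the side `(i₀, σ₀)` of the box `Icc Lo Hi`:
coefficients `(c_α, c_β)` of an integer linear form `L`, thresholds `θ`, and the equivalence `m ≤ sdepth v ↔ θ m ≤ L (φ v)` for the DEPTH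
`sdepth` behind that side; plus a climbing axis `a` and sign `s` with `s·c_a > 0`.  The apron of `SkelPhiApron` is then placed by arithmetic:
height profile `apronK` (every `ℓ`-box of the apron strictly below the shell line `θ D`), and the kit centre's row `kitK` (at `L ≥ θ D + A`).
* §1 `sdepth`, **`SideForm`**, `UL` (`= |c_α| + |c_β|`), `lin`, `lin_apronPt`, `abs_lin_sub_le_of_mem_box`;
* §2 **`apronK`**, `lin_apronPt_lt_of_le_apronK` (boxes below the line), `sdepth_lt_of_apron` / `le_sdepth_of_apron` (vertices `φ`-within `ℓ` of an
  apron point have `1 ≤ sdepth < D`);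
* §3 **`kitK`**, `le_lin_kitPt` / `lin_kitPt_lt` (the centre's row), `le_sdepth_of_lin` (depth `≥ D` from `L ≥ θ D`);
* §4 the capture indices: **`captureIdx`**, `captureIdx_spec` (for `w` just below the line: admissible `(m, k)` with `φ w − apronPt m k = ℓ(s e_a + s_b e_b)`).
[cite: KozmaNitzan2024, §4 Lemma 10, p. 21 ("Q ⊆ S"), pp. 21–22 (Step V)] [cite: MartineauTassion2017, §4.3 (cells z₁u + z₂v + P)]
-/

noncomputable section

open scoped Classical

namespace Summit.CriticalPhenomena.PercolationContinuityZ3.Theorems.Transplant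

namespace Skelφ

open Literature.Probability.Percolation Literature.Probability.LatticeModels SimpleGraph
open Literature.Probability.Percolation.KozmaNitzan.Cells (oth oth_ne eq_oth_of_ne oth_oth)

variable {V : Type}

/-! ## §1 Depth behind a side; side forms -/

/-- **The depth of `v` behind the side `(i₀, σ₀)` of the box `Icc Lo Hi`** (`σ₀ = 1`: the side `ψ · i₀ = Hi i₀`; else the side `Lo i₀`), in units of
the window map. [this work] -/
def sdepth (ψ : V → Site 2) (Lo Hi : Site 2) (i₀ : Fin 2) (σ₀ : ℤˣ) (v : V) : ℤ :=
  if (σ₀ : ℤ) = 1 then Hi i₀ - ψ v i₀ else ψ v i₀ - Lo i₀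

/-- **A side form**: the side `(i₀, σ₀)` of the `ψ`-box `Icc Lo Hi` seen from the base chart `φ` — an integer linear form `L = c_α·α + c_β·β`,
thresholds `θ` with `m ≤ sdepth v ↔ θ m ≤ L(φ v)`, and a climbing axis `a` / sign `s` with `s·c_a > 0`. [this work] -/
structure SideForm (ψ φ : V → Site 2) (Lo Hi : Site 2) (i₀ : Fin 2) (σ₀ : ℤˣ) where
  /-- coefficient of `α` -/
  cα : ℤ
  /-- coefficient of `β` -/
  cβ : ℤ
  /-- thresholds: depth `≥ m` iff `L ≥ θ m` -/
  θ : ℤ → ℤ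
  /-- the climbing axis of the apron -/
  a : Fin 2
  /-- the climbing sign -/
  s : ℤˣ
  /-- `L` increases along `s e_a` -/
  clim : 0 < (s : ℤ) * coef cα cβ a
  /-- the dictionary -/
  depth_iff : ∀ (v : V) (m : ℤ), m ≤ sdepth ψ Lo Hi i₀ σ₀ v ↔ θ m ≤ linForm cα cβ (φ v)

namespace SideForm

variable {ψ φ : V → Site 2} {Lo Hi : Site 2} {i₀ : Fin 2} {σ₀ : ℤˣ} (F : SideForm ψ φ Lo Hi i₀ σ₀)

/-- The Lipschitz constant `|c_α| + |c_β|` of the form. [folklore] -/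
def UL : ℕ := F.cα.natAbs + F.cβ.natAbs

/-- The form on planar points. [folklore] -/
def lin (z : Site 2) : ℤ := linForm F.cα F.cβ z

/-- `UL` as an integer. [folklore] -/
theorem UL_eq : (F.UL : ℤ) = |F.cα| + |F.cβ| := by unfold UL; push_cast; rfl

/-- The climbing coefficient `s·c_a` is positive. [folklore] -/
theorem clim_pos : 0 < (F.s : ℤ) * coef F.cα F.cβ F.a := F.clim

/-- The form along the apron: `L(apronPt z a s m k) = L(z) + m·c_b + k·(s c_a)`. [folklore] -/
theorem lin_apronPt (z : Site 2) (m : ℤ) (k : ℕ) :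
    F.lin (apronPt z F.a F.s m k) = F.lin z + m * coef F.cα F.cβ (oth F.a) + (k : ℤ) * ((F.s : ℤ) * coef F.cα F.cβ F.a) := by
  unfold lin apronPt
  rw [linForm_add_single, linForm_add_single]; ring

/-- A point `φ`-within `ℓ` of `z` has `|L − L(z)| ≤ ℓ·UL`. [folklore] -/
theorem abs_lin_sub_le_of_mem_box {x z : Site 2} {ℓ : ℕ} (h : x - z ∈ box 2 ℓ) : |F.lin x - F.lin z| ≤ (ℓ : ℤ) * F.UL := by
  rw [mem_box] at h
  have h0 := h 0; have h1 := h 1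
  simp only [Pi.sub_apply] at h0 h1
  rw [UL_eq]
  exact abs_linForm_sub_le_mul F.cα F.cβ (abs_le.2 ⟨h0.1, h0.2⟩) (abs_le.2 ⟨h1.1, h1.2⟩)

/-- Depth at least `m` from `L ≥ θ m`. [folklore] -/
theorem le_sdepth_of_lin {v : V} {m : ℤ} (h : F.θ m ≤ F.lin (φ v)) : m ≤ sdepth ψ Lo Hi i₀ σ₀ v := (F.depth_iff v m).2 h

/-- Depth below `m` from `L < θ m`. [folklore] -/
theorem sdepth_lt_of_lin {v : V} {m : ℤ} (h : F.lin (φ v) < F.θ m) : sdepth ψ Lo Hi i₀ σ₀ v < m := by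
  by_contra hc; push Not at hc
  exact absurd ((F.depth_iff v m).1 hc) (not_le.2 h)

/-- `L < θ m` from depth below `m`. [folklore] -/
theorem lin_lt_of_sdepth_lt {v : V} {m : ℤ} (h : sdepth ψ Lo Hi i₀ σ₀ v < m) : F.lin (φ v) < F.θ m := by
  by_contra hc; push Not at hc
  exact absurd ((F.depth_iff v m).2 hc) (not_le.2 h)

/-- `θ m ≤ L` from depth at least `m`. [folklore] -/
theorem le_lin_of_le_sdepth {v : V} {m : ℤ} (h : m ≤ sdepth ψ Lo Hi i₀ σ₀ v) : F.θ m ≤ F.lin (φ v) := (F.depth_iff v m).1 h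

/-! ## §2 The height profile of the apron below the shell line -/

/-- **The height profile**: the number of climbing rows above the base point `(m, 0)` whose `ℓ`-boxes stay strictly below the line `θ D`. [this work] -/
def apronK (z : Site 2) (D : ℤ) (ℓ : ℕ) (m : ℤ) : ℕ :=
  Int.toNat ((F.θ D - 1 - F.lin (apronPt z F.a F.s m 0) - ℓ * F.UL) / ((F.s : ℤ) * coef F.cα F.cβ F.a))

/-- **Apron boxes lie below the shell line**: if the base box `(m, 0)` does (`L + ℓ·UL < θ D`), so does every box `(m, k)`, `k ≤ apronK m`. [this work] -/
theorem lin_apronPt_lt_of_le_apronK {z : Site 2} {D : ℤ} {ℓ : ℕ} {m : ℤ} (hbase : F.lin (apronPt z F.a F.s m 0) + ℓ * F.UL < F.θ D) {k : ℕ}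
    (hk : k ≤ F.apronK z D ℓ m) : F.lin (apronPt z F.a F.s m k) + ℓ * F.UL < F.θ D := by
  have hc := F.clim_pos
  set C := (F.s : ℤ) * coef F.cα F.cβ F.a with hC
  set q := (F.θ D - 1 - F.lin (apronPt z F.a F.s m 0) - ℓ * F.UL) / C with hq
  have hq0 : 0 ≤ F.θ D - 1 - F.lin (apronPt z F.a F.s m 0) - ℓ * F.UL := by linarith
  have hk' : (k : ℤ) ≤ q := by
    have : (F.apronK z D ℓ m : ℤ) = q := by
      unfold apronK; rw [← hC, ← hq]; exact Int.toNat_of_nonneg (Int.ediv_nonneg hq0 hc.le)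
    rw [← this]; exact_mod_cast hk
  have hqC : q * C ≤ F.θ D - 1 - F.lin (apronPt z F.a F.s m 0) - ℓ * F.UL := Int.ediv_mul_le _ hc.ne'
  have e : F.lin (apronPt z F.a F.s m k) = F.lin (apronPt z F.a F.s m 0) + (k : ℤ) * C := by rw [lin_apronPt, lin_apronPt]; push_cast; ring
  rw [e]
  nlinarith

/-- **Vertices of an apron box are out of the shell**: `φ v` within `ℓ` of the apron point `(m, k)`, `k ≤ apronK m`, base box below the line ⇒
`sdepth v < D`. [this work] -/
theorem sdepth_lt_of_apron {z : Site 2} {D : ℤ} {ℓ : ℕ} {m : ℤ} (hbase : F.lin (apronPt z F.a F.s m 0) + ℓ * F.UL < F.θ D) {k : ℕ}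
    (hk : k ≤ F.apronK z D ℓ m) {v : V} (hv : φ v - apronPt z F.a F.s m k ∈ box 2 ℓ) : sdepth ψ Lo Hi i₀ σ₀ v < D := by
  have h1 := F.lin_apronPt_lt_of_le_apronK hbase hk
  have h2 := F.abs_lin_sub_le_of_mem_box hv
  rw [abs_le] at h2
  exact F.sdepth_lt_of_lin (by linarith [h2.2])

/-- **Vertices of an apron box are behind the boundary layer**: if the base box `(m, 0)` lies above the line `θ 1` (`θ 1 ≤ L − ℓ·UL`) then every
vertex `φ`-within `ℓ` of the apron point `(m, k)` has `1 ≤ sdepth`. [this work] -/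
theorem le_sdepth_of_apron {z : Site 2} {ℓ : ℕ} {m : ℤ} (hlow : F.θ 1 ≤ F.lin (apronPt z F.a F.s m 0) - ℓ * F.UL) (k : ℕ) {v : V}
    (hv : φ v - apronPt z F.a F.s m k ∈ box 2 ℓ) : 1 ≤ sdepth ψ Lo Hi i₀ σ₀ v := by
  have hc := F.clim_pos
  have h2 := F.abs_lin_sub_le_of_mem_box hv
  rw [abs_le] at h2
  have e : F.lin (apronPt z F.a F.s m k) = F.lin (apronPt z F.a F.s m 0) + (k : ℤ) * ((F.s : ℤ) * coef F.cα F.cβ F.a) := by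
    rw [lin_apronPt, lin_apronPt]; push_cast; ring
  have hk0 : (0 : ℤ) ≤ (k : ℤ) * ((F.s : ℤ) * coef F.cα F.cβ F.a) := by positivity
  exact F.le_sdepth_of_lin (by linarith [h2.1])

/-! ## §3 The row of the kit centre above the shell line -/

/-- **The kit centre's row**: the least number of climbing rows above `z` at which `L ≥ θ D + A`. [this work] -/
def kitK (z : Site 2) (D A : ℤ) : ℕ := Int.toNat (-((F.lin z - (F.θ D + A)) / ((F.s : ℤ) * coef F.cα F.cβ F.a)))

/-- The kit centre's planar point. [folklore] -/
def kitPt (z : Site 2) (D A : ℤ) : Site 2 := z + Pi.single F.a ((F.kitK z D A : ℤ) * (F.s : ℤ))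

/-- `L` at the kit point is at least `θ D + A` (when `L(z) ≤ θ D + A`). [this work] -/
theorem le_lin_kitPt {z : Site 2} {D A : ℤ} (hz : F.lin z ≤ F.θ D + A) : F.θ D + A ≤ F.lin (F.kitPt z D A) := by
  have hc := F.clim_pos
  set C := (F.s : ℤ) * coef F.cα F.cβ F.a with hC
  unfold kitPt; rw [show F.lin (z + Pi.single F.a ((F.kitK z D A : ℤ) * (F.s : ℤ))) = F.lin z + (F.kitK z D A : ℤ) * C by
    unfold lin; rw [linForm_add_single]; ring]
  -- `kitK = -((L z − θ D − A)/C) ≥ (θ D + A − L z)/C`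
  have hnn : 0 ≤ -((F.lin z - (F.θ D + A)) / C) := by
    have := Int.ediv_le_ediv hc (show F.lin z - (F.θ D + A) ≤ 0 by linarith)
    rw [Int.zero_ediv] at this; linarith
  have hK : (F.kitK z D A : ℤ) = -((F.lin z - (F.θ D + A)) / C) := by unfold kitK; rw [← hC]; exact Int.toNat_of_nonneg hnn
  rw [hK]
  have h1 := Int.lt_ediv_add_one_mul_self (F.lin z - (F.θ D + A)) hc
  -- `(x / C) * C ≤ x`, so `-(x/C) * C ≥ -x`
  have h2 := Int.ediv_mul_le (F.lin z - (F.θ D + A)) hc.ne'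
  nlinarith

/-- `L` at the kit point is below `θ D + A + s c_a` (when `L(z) ≤ θ D + A`). [this work] -/
theorem lin_kitPt_lt {z : Site 2} {D A : ℤ} (hz : F.lin z ≤ F.θ D + A) :
    F.lin (F.kitPt z D A) < F.θ D + A + (F.s : ℤ) * coef F.cα F.cβ F.a := by
  have hc := F.clim_pos
  set C := (F.s : ℤ) * coef F.cα F.cβ F.a with hC
  unfold kitPt; rw [show F.lin (z + Pi.single F.a ((F.kitK z D A : ℤ) * (F.s : ℤ))) = F.lin z + (F.kitK z D A : ℤ) * C by
    unfold lin; rw [linForm_add_single]; ring]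
  have hnn : 0 ≤ -((F.lin z - (F.θ D + A)) / C) := by
    have := Int.ediv_le_ediv hc (show F.lin z - (F.θ D + A) ≤ 0 by linarith)
    rw [Int.zero_ediv] at this; linarith
  have hK : (F.kitK z D A : ℤ) = -((F.lin z - (F.θ D + A)) / C) := by unfold kitK; rw [← hC]; exact Int.toNat_of_nonneg hnn
  rw [hK]
  have h1 := Int.lt_ediv_add_one_mul_self (F.lin z - (F.θ D + A)) hc
  nlinarith

/-- The kit row is at most `(θ D + A − L(z))/(s c_a) + 1`. [folklore] -/
theorem kitK_le {z : Site 2} {D A : ℤ} (hz : F.lin z ≤ F.θ D + A) :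
    (F.kitK z D A : ℤ) * ((F.s : ℤ) * coef F.cα F.cβ F.a) ≤ F.θ D + A - F.lin z + (F.s : ℤ) * coef F.cα F.cβ F.a := by
  have h := F.lin_kitPt_lt hz
  unfold kitPt at h
  rw [show F.lin (z + Pi.single F.a ((F.kitK z D A : ℤ) * (F.s : ℤ))) = F.lin z + (F.kitK z D A : ℤ) * ((F.s : ℤ) * coef F.cα F.cβ F.a) by
    unfold lin; rw [linForm_add_single]; ring] at h
  linarith

/-! ## §4 Capture indices: where a vertex just below the line sits in the apron -/

/-- The sign of the tangential coefficient (as `±1`, `+1` at `0`). [folklore] -/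
def sb : ℤ := if 0 ≤ coef F.cα F.cβ (oth F.a) then 1 else -1

/-- `sb · c_b = |c_b|`. [folklore] -/
theorem sb_mul_coef : F.sb * coef F.cα F.cβ (oth F.a) = |coef F.cα F.cβ (oth F.a)| := by
  unfold sb; split_ifs with h
  · rw [one_mul, abs_of_nonneg h]
  · rw [abs_of_neg (not_le.1 h)]; ring

/-- `|sb| = 1`-type facts. [folklore] -/
theorem sb_cases : F.sb = 1 ∨ F.sb = -1 := by unfold sb; split_ifs <;> simp

/-- **The capture indices** of a planar point `x` (relative to the apron base `z`): shift `x` down-diagonally by `ℓ(s e_a + s_b e_b)` and read off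
`(m, k)`. [this work] -/
def captureIdx (z x : Site 2) (ℓ : ℕ) : ℤ × ℤ :=
  ((x - z) (oth F.a) - ℓ * F.sb, (F.s : ℤ) * (x - z) F.a - ℓ)

/-- **Capture geometry**: with `(m, k) = captureIdx z x ℓ` and `k ≥ 0`, `x − apronPt z a s m k = ℓ(s e_a + s_b e_b)`, a point of `box 2 ℓ`; and
`L(apronPt z a s m k) + ℓ·UL = L(x)`. [this work] -/
theorem captureIdx_spec (z x : Site 2) (ℓ : ℕ) {k : ℕ} (hk : (k : ℤ) = (F.captureIdx z x ℓ).2) :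
    x - apronPt z F.a F.s (F.captureIdx z x ℓ).1 k ∈ box 2 ℓ ∧ F.lin (apronPt z F.a F.s (F.captureIdx z x ℓ).1 k) + ℓ * F.UL = F.lin x := by
  have hs : (F.s : ℤ) * (F.s : ℤ) = 1 := by rcases Int.units_eq_one_or F.s with h | h <;> simp [h]
  have hs1 : |(F.s : ℤ)| = 1 := by rcases Int.units_eq_one_or F.s with h | h <;> simp [h]
  have hsb1 : |F.sb| = 1 := by rcases F.sb_cases with h | h <;> simp [h]
  -- the displacement `x − apronPt` coordinatewise
  have hdisp_a : (x - apronPt z F.a F.s (F.captureIdx z x ℓ).1 k) F.a = ℓ * (F.s : ℤ) := by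
    unfold apronPt captureIdx at *
    simp only [Pi.sub_apply, Pi.add_apply, Pi.single_eq_same, Pi.single_eq_of_ne (oth_ne F.a).symm]
    have : (k : ℤ) * (F.s : ℤ) = ((F.s : ℤ) * (x F.a - z F.a) - ℓ) * F.s := by rw [hk]; simp [Pi.sub_apply]
    rw [this]; linear_combination (z F.a - x F.a) * hs
  have hdisp_b : (x - apronPt z F.a F.s (F.captureIdx z x ℓ).1 k) (oth F.a) = ℓ * F.sb := by
    unfold apronPt captureIdx
    simp only [Pi.sub_apply, Pi.add_apply, Pi.single_eq_same, Pi.single_eq_of_ne (oth_ne F.a)]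
    ring
  refine ⟨?_, ?_⟩
  · rw [mem_box]
    intro i
    by_cases hi : i = F.a
    · rw [hi, hdisp_a]
      rcases Int.units_eq_one_or F.s with h | h <;> rw [h] <;> push_cast <;> constructor <;> linarith
    · rw [eq_oth_of_ne hi, hdisp_b]
      rcases F.sb_cases with h | h <;> rw [h] <;> constructor <;> linarith
  · -- `L(x) − L(apronPt) = ℓ s c_a·s... = ℓ |c_a| + ℓ |c_b|`
    have e : x = apronPt z F.a F.s (F.captureIdx z x ℓ).1 k + Pi.single F.a ((ℓ : ℤ) * (F.s : ℤ)) + Pi.single (oth F.a) ((ℓ : ℤ) * F.sb) := by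
      funext i
      by_cases hi : i = F.a
      · subst hi
        have := hdisp_a
        simp only [Pi.sub_apply] at this
        simp only [Pi.add_apply, Pi.single_eq_same, Pi.single_eq_of_ne (oth_ne F.a).symm]; linarith
      · rw [eq_oth_of_ne hi]
        have := hdisp_b
        simp only [Pi.sub_apply] at this
        simp only [Pi.add_apply, Pi.single_eq_same, Pi.single_eq_of_ne (oth_ne F.a)]; linarith
    conv_rhs => rw [e]
    unfold lin
    rw [linForm_add_single, linForm_add_single]
    have hca : (ℓ : ℤ) * (F.s : ℤ) * coef F.cα F.cβ F.a = ℓ * |coef F.cα F.cβ F.a| := by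
      have hpos := F.clim_pos
      rw [show |coef F.cα F.cβ F.a| = (F.s : ℤ) * coef F.cα F.cβ F.a by
        rcases Int.units_eq_one_or F.s with h | h
        · rw [h] at hpos ⊢; push_cast at hpos ⊢; rw [one_mul] at hpos ⊢; exact abs_of_pos hpos
        · rw [h] at hpos ⊢; push_cast at hpos ⊢
          rw [abs_of_neg (by linarith)]; ring]
      ring
    have hcb : (ℓ : ℤ) * F.sb * coef F.cα F.cβ (oth F.a) = ℓ * |coef F.cα F.cβ (oth F.a)| := by rw [mul_assoc, sb_mul_coef]
    rw [hca, hcb, UL_eq, ← abs_coef_add F.cα F.cβ F.a]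
    ring

end SideForm

end Skelφ

end Summit.CriticalPhenomena.PercolationContinuityZ3.Theorems.Transplant

end
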